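import Summits.CriticalPhenomena.PercolationContinuityZ3.Theorems.PercNearOneGluingNoHeavyLowerTailThreePointProductFormKrein

/-!
# LEMMA Λ, definitions: the leak quotient of the box problem: the physical letters on the 5 coordinates `(t, −e₁′, −e₂′, o₁, G)`
# (Sahi programme, prover prim-sahi-p2 gen 66)

Support file (`--supports stmt-CriticalPhenomena-4575`).  Standard axioms, no sorries, no named facts.
Memo `run/shared/lean/prim/prim-sahi/FROM-prim-sahi-p2-gen66-KREIN-STRUCTURE.md` §5b, `prim-sahi-p2/PROOF-E3.md` §76.

A PHYSICAL letter of the one-child boundary-star cycle is `θ = (s,d)` with `|d| ≤ s` (child `(u,w) = ((s+d)/2, (s−d)/2) ≥ 0`): on the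
12-state normal form of `…ProductFormABPlus` it acts by `s²·P + sd·R + d²·Q` (`bstepA`, `bstepB`, componentwise).  By `…ProductFormKrein`
(`Lam_stepA`, `col1_eq`) the five coordinates `z = (τ, v₁, v₂, η, G) := (t, −e₁′, −e₂′, o₁, −Λ − (7/30)t)` (`Λ = ℓ₀ + (28/3)e₁′ + 7e₂′` the leak
coordinate) form a QUOTIENT: `zOf (bstepA s d v) = Astep s d (zOf v)` (`zOf_bstepA`) with the explicit quadratic pencil `Astep` below.
LEMMA Λ (gen 66 memo §4(i); files `…LeakCone*`): `Λ ≤ −(7/30)·t`, i.e. `0 ≤ G`, on every state reached from `ω` by a nonempty physical word.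
[this work] (gen 66).
-/

namespace Summit.CriticalPhenomena.PercolationContinuityZ3.Theorems.ProductFormABPlus

/-- Componentwise linear combination `a·u + b·v + c·w` of three `a`-states. [this work] -/
def combA (a b c : ℚ) (u v w : StA) : StA :=
  ⟨a * u.t + b * v.t + c * w.t, a * u.l0 + b * v.l0 + c * w.l0, a * u.e1a + b * v.e1a + c * w.e1a, a * u.e2a + b * v.e2a + c * w.e2a,
   a * u.e1b + b * v.e1b + c * w.e1b, a * u.e2b + b * v.e2b + c * w.e2b, a * u.o1 + b * v.o1 + c * w.o1, a * u.o2 + b * v.o2 + c * w.o2⟩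

/-- The physical letter `θ = (s,d)`: `s²·P + d²·Q + sd·R` on the `a`-part. [this work] -/
def bstepA (s d : ℚ) (v : StA) : StA := combA (s ^ 2) (d ^ 2) (s * d) (stepA .p v) (stepA .q v) (stepA .r v)

/-- A word of physical letters acting on an `a`-state (head letter acts last). [this work] -/
def brunA : List (ℚ × ℚ) → StA → StA
  | [], v => v
  | θ :: w, v => bstepA θ.1 θ.2 (brunA w v)

/-- The five quotient coordinates `(τ, v₁, v₂, η, G) = (t, −e₁′, −e₂′, o₁, −Λ − (7/30)t)` packed as a function `Fin 5 → ℚ` is avoided: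
we use a plain structure. [this work] -/
@[ext] structure Z5 where
  /-- `τ = t` -/
  τ : ℚ
  /-- `v₁ = −e₁′` -/
  v₁ : ℚ
  /-- `v₂ = −e₂′` -/
  v₂ : ℚ
  /-- `η = o₁` -/
  η : ℚ
  /-- `G = −Λ − (7/30)t` -/
  G : ℚ

/-- The quotient map `StA → Z5`. [this work] -/
def zOf (v : StA) : Z5 := ⟨v.t, -v.e1a, -v.e2a, v.o1, -(Lam v) - (7/30) * v.t⟩

/-- The physical letter on the quotient: `z ↦ (s²A₀ + sdA₁ + d²A₂) z` (explicit; memo §5b). [this work] -/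
def Astep (s d : ℚ) (z : Z5) : Z5 :=
  ⟨(s^2*(((3:ℚ)/4)*z.τ) + d^2*(((1:ℚ)/4)*z.τ)),
   (s^2*(((3:ℚ)/640)*z.τ + ((-5:ℚ)/2)*z.v₂) + (s*d)*((-1:ℚ)*z.η) + d^2*(((9:ℚ)/128)*z.τ + ((3:ℚ)/4)*z.v₁ + ((37:ℚ)/16)*z.v₂)),
   (s^2*(((3:ℚ)/160)*z.τ + (1:ℚ)*z.v₁ + ((15:ℚ)/4)*z.v₂) + d^2*(((-3:ℚ)/160)*z.τ)),
   (s^2*(((5:ℚ)/4)*z.η) + (s*d)*(((-3:ℚ)/80)*z.τ + ((-3:ℚ)/4)*z.v₁ + ((-37:ℚ)/16)*z.v₂) + d^2*(((1:ℚ)/4)*z.η)),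
   (s^2*(((7:ℚ)/40)*z.τ + ((3:ℚ)/4)*z.G) + (s*d)*(((-28:ℚ)/3)*z.η) + d^2*(((7:ℚ)/24)*z.τ + ((14:ℚ)/9)*z.v₁ + ((161:ℚ)/18)*z.v₂ + ((1:ℚ)/4)*z.G))⟩

/-- ★ The quotient property: `zOf (bstepA s d v) = Astep s d (zOf v)`. [this work] -/
theorem zOf_bstepA (s d : ℚ) (v : StA) : zOf (bstepA s d v) = Astep s d (zOf v) := by
  simp only [zOf, bstepA, combA, stepA, Astep, Lam]
  ext <;> simp only <;> ring

/-- `zOf ω_a = (8/3, 0, 0, 0, −28/45)`. [this work] -/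
theorem zOf_omegaA : zOf omegaA = ⟨8/3, 0, 0, 0, -(28/45)⟩ := by
  simp only [zOf, omegaA, Lam]; ext <;> norm_num

/-- The rational cone `K_ℚ` of the leak quotient (memo §5b): 10 linear + 2 quadratic constraints; `ã = v₁ + (23/8)v₂`, `ã₋ = v₁ + (7/8)v₂`. [this work] -/
def inK (z : Z5) : Prop :=
  0 ≤ ((1:ℚ)*z.τ) ∧
  0 ≤ ((1:ℚ)*z.v₂) ∧
  0 ≤ ((1:ℚ)*z.v₁ + ((7:ℚ)/8)*z.v₂) ∧
  0 ≤ (((1:ℚ)/10)*z.τ + ((-14:ℚ)/25)*z.v₁ + ((39:ℚ)/100)*z.v₂) ∧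
  0 ≤ (((3:ℚ)/100)*z.τ + ((-19:ℚ)/50)*z.v₁ + ((363:ℚ)/400)*z.v₂) ∧
  0 ≤ (((1:ℚ)/50)*z.τ + ((1:ℚ)/2)*z.v₁ + ((23:ℚ)/16)*z.v₂ + (-1:ℚ)*z.η) ∧
  0 ≤ (((1:ℚ)/50)*z.τ + ((1:ℚ)/2)*z.v₁ + ((23:ℚ)/16)*z.v₂ + (1:ℚ)*z.η) ∧
  0 ≤ (((3:ℚ)/5)*z.v₁ + ((37:ℚ)/40)*z.v₂ + (-1:ℚ)*z.η) ∧
  0 ≤ (((3:ℚ)/5)*z.v₁ + ((37:ℚ)/40)*z.v₂ + (1:ℚ)*z.η) ∧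
  0 ≤ ((1:ℚ)*z.G) ∧
  0 ≤ ((-1:ℚ)*z.η*z.η + ((9:ℚ)/8)*z.v₂*z.v₂ + ((27:ℚ)/16)*z.v₁*z.v₂ + ((9:ℚ)/20)*z.v₁*z.v₁) ∧
  0 ≤ ((-25:ℚ)*z.η*z.η + ((23:ℚ)/4)*z.v₂*z.G + (2:ℚ)*z.v₁*z.G + ((7:ℚ)/10)*z.τ*z.G)


end Summit.CriticalPhenomena.PercolationContinuityZ3.Theorems.ProductFormABPlus
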